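import Summits.BirchSwinnertonDyer.Rank1Residual.O6.X4CongruenceAnchor
import Summits.BirchSwinnertonDyer.Rank1Residual.Additive.PotSupersingularClasses
import Literature.NumberTheory.EllipticCurves.Kato2004.AdditivePotGoodRankZeroShaUpperBoundFineSelmer
import HarnessLib

/-!
# Route `KatoDescentPotSupersingular` (rung K9, cell `bsd-potss`): the CONGRUENCE ROAD to the Conj-A crux
# `WildFineSelmerCoatesSujatha` (item stmt-BirchSwinnertonDyer-19386) — Coates–Sujatha's (A) at `(E,3)`
# is an invariant of the Galois module `E[3]` (Lim–Sujatha 2018), so each row is discharged by ONE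
# congruent curve on which (A) is known; ROUTE-FREE (a `--supports … --as helper` file; seat
# `bsd-potss-k9-c4` g3; nothing booked, BSD is not proved by any of this)

THE CRUX. Item 19386 asks, for every globally minimal `W/ℚ` of analytic rank `0` in `ClassO6` at `3`
(additive, potentially good, WILD) with `W[3]` irreducible, 3-adic tower NOT onto and no CM, that the
Pontryagin dual `Y(E/ℚ^cyc)` of the fine Selmer group be `ℤ₃`-finitely generated — Coates–Sujatha's
statement (A) at `(E,3)`, in the tree's `∃`-form over `WeierstrassCurve.FineSelmerDualData`.  Inside
`closes` it feeds Kato's Thm. 14.5 (3) in the fine-Selmer reading (the named fact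
`Kato2004.rankZero_…_of_irreducible_of_fineSelmerDual_fg`, p420034) on the NON-CM ♯ rows of the U₀-ns child
(after the Heegner road: `3 ∣ ∏c_ℓ` or no Manin-clean datum; census: 163 of 364 tower-NO cells, among them
ALL 344 rows with mod-3 image in a Cartan normaliser are eligible).  Its one printed source so far was
Iwasawa's `μ = 0` for `ℚ(E[3])^cyc` (Coates–Sujatha Thm. 3.4) — never available on an irreducible row —
and the Deo–Ray–Sujatha criterion `H²(ℚ_S/ℚ, E[3]) = 0`, void on every ♯ row (k8t-c4 g3, p439271).

THE ROAD (this file). **(A) at `(E,p)` depends only on the `G_ℚ`-module `E[p]`** — IN PRINT: M. F. Lim,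
R. Sujatha, J. Number Theory 187 (2018) 66–91, §3, Prop. 3.2 ("Suppose that there is an isomorphism
`A[π] ≅ B[π]` of `G_S(F)`-modules. Then Conjecture A holds for `Y_S(A/F^cyc)` if and only if Conjecture A
holds for `Y_S(B/F^cyc)`"; held text `paper:arxiv-1603.08640` p. 8; earlier R. Sujatha 2010) — filed by
this seat as ONE Literature named fact (`LimSujatha2018.prop32_fineSelmerDual_moduleFinite_iff_of_torsionIso`,
`Literature/NumberTheory/EllipticCurves/FineSelmerCongruentCurves.lean`, review-queued) and carried here
SPELLED OUT as the section hypothesis `hLS` (`§0`); the o6-r1 lane typed the same sentence over an uninstantiated interface `FineMuZero` as the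
`@[conjecture]` `O6.FineMuZeroCongruenceInvariant`, `O6/X4CongruenceAnchor.lean`, because the tree then
had no fine-Selmer object — it has one now: `KatoFineSelmerDual`, p420034, k8t-c4's p427326).  Hence:

* `§1` the ROW TRANSFER: (A) at `(W,3)` ⟸ (A) at `(W′,3)` for ANY elliptic `W′/ℚ` with `W′[3] ≃ W[3]`
  `Γ_ℚ`-equivariantly (`O6.ModPCongruent`) — `conjA_of_modPCongruent`; and the interface instance
  `fineMuZeroCongruenceInvariant_conjA : O6.FineMuZeroCongruenceInvariant ⟨Conj A⟩` (o6-r1's (T-μ) is,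
  at the Conj-A binding, the printed Lim–Sujatha proposition);
* `§2` the interface instance of o6-r1's export (Kμ-K): `x4UpperOfFineMuZero_conjA :
  O6.X4UpperOfFineMuZero ⟨Conj A⟩` IS the fine-Selmer Kato fact p420034 (so o6-r1's composite T-X4E
  `X4UpperOfCongruentUnitAnchor` now rests on p420034 + Lim–Sujatha + the ONE remaining reading (A⋆)
  `FineMuZeroOfUnitAnchor ⟨Conj A⟩` — `x4UpperOfCongruentUnitAnchor_of_conjA`);
* `§3` the K9 currency: on an irreducible O6 row of analytic rank `0`, a congruent curve `W′` with (A) at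
  `(W′,3)` gives `MissingUpperBoundAt W 3` (p420034 + GZK + modularity + Lim–Sujatha) —
  `missingUpperBoundAt_wild_of_congruentConjA`;
* `§4` the BODY of `WildFineSelmerCoatesSujatha` (and its ♯-restriction, the `hCS♯` binder of
  `WildUpperHeegnerRoad.wildUpperNonsurjTower_of_lower_of_rankOne_of_fineSelmerSharp`, p438322) from
  PER-ROW CONGRUENT CERTIFICATES: `∃ W′, W′[3] ≃ W[3] ∧ (A) at (W′,3)` —
  `wildFineSelmerCoatesSujatha_of_congruentCertificates`, `wildFineSelmerSharp_of_congruentCertificates`.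

ANCHORS (what certifies (A) at `(W′,3)`; NOT proved here). (a) o6-r1's KATO UNIT ANCHORS (A⋆): `W′`
additive potentially good at `3` with Kato's (12.5.2), `W′(ℚ₃)[3] = 0`, unit `L(W′,1)/Ω′` — census pilot
C-X4E-0 (o6-r1 GEN 22, kit j158549/j158590): 18 of the 20 ELKIES rows (ρ̄₃ onto, ρ₉ not) have ≥ 2 certified
congruent unit anchors below `5·10⁵`; the 344 Cartan-normaliser rows admit NO Kato anchor (same mod-3
image).  (b) NEW — ORDINARY ANCHORS for the Cartan rows: `W′` with GOOD ORDINARY reduction at `3` and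
`μ(X(W′/ℚ^cyc)) = 0` (classical Selmer dual; then `Y(W′) = X(W′)/…` is `ℤ₃`-f.g.), certified per curve by
Greenberg's Thm. 4.1 (tree: `SelmerDualData.constantCoeff_charGenerator_mul_natCard_of_finite_selmerGroup_of_ordinary`:
`Sel_{3^∞}(W′/ℚ) = 0`, `3 ∤ ∏c_ℓ(W′)`, `a₃(W′) ≢ 1` ⟹ `X(W′/ℚ^cyc)` finite) or by Kato 17.4 + `μ_an = 0`
— the image of `W′[3]` is irrelevant to the ORDINARY theory, which is what breaks the symmetry that kills
every `E[3]`-only criterion on the ♯ rows.  In-tree gap for (b): the inclusion `Sel₀(ℚ^cyc) ≤ Sel(ℚ^cyc)`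
between the tree's two Selmer libraries (`GreenbergSelmer` decomposition-group conditions vs
`SubgroupSelmer` completion conditions; the X11b `LocalTrivialityBridge` pattern at `H = ker κ`) — WANTED;
the X2 lane's kernel transfer `MuVanishingOfFiniteModP` / `MuTransferDerived` is the model.  No census
number is an input of any theorem below.  CONDITIONAL (audit `proof.conditional`); item 19386 is NOT
closed; BSD is not proved by any of this.

References: [LimSujatha2018] §3 Prop. 3.2 (arXiv:1603.08640 p. 8); [CoatesSujatha2005] Conj. A, §3;
[Kato2004Asterisque] Thm. 12.4 (3), 12.5 (3)–(4), 14.5 (3) (p. 236), Prop. 14.16 (2) (p. 244);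
[GreenbergVatsal2000] Thm. (1.4); [GreenbergLNM1716] Thm. 4.1; [Miller2011LMS] Def. 1.1.
-/

set_option autoImplicit false
-- sibling precedent (`KatoDescentPotSupersingularAssembly.lean`): the directory name repeats the summit name
set_option linter.dupNamespace false

noncomputable section

open scoped Classical

namespace Summit.BirchSwinnertonDyer.BirchSwinnertonDyer.Theorems.WildFineSelmerCongruence

open WeierstrassCurve Literature.NumberTheory.EllipticCurves
  Literature.NumberTheory.EllipticCurves.Rank1Residual
  Literature.NumberTheory.EllipticCurves.Rank1Residual.Typed
  Summit.BirchSwinnertonDyer.Rank1Residual Summit.BirchSwinnertonDyer.Rank1Residual.Additive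
  Summit.BirchSwinnertonDyer.Rank1Residual.O6

/-! ## §0 The printed input, carried INLINE: Lim–Sujatha 2018, Prop. 3.2

The one published input of the road — "Suppose that there is an isomorphism `A[π] ≅ B[π]` of
`G_S(F)`-modules. Then [(A)] holds for `Y_S(A/F^cyc)` if and only if [(A)] holds for `Y_S(B/F^cyc)`"
(M. F. Lim, R. Sujatha, J. Number Theory 187 (2018) 66–91, §3 Prop. 3.2; held text
`paper:arxiv-1603.08640` p. 8) — is filed SEPARATELY as the Literature named fact
`Literature.NumberTheory.EllipticCurves.LimSujatha2018.prop32_fineSelmerDual_moduleFinite_iff_of_torsionIso`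
(statement-only file `Literature/NumberTheory/EllipticCurves/FineSelmerCongruentCurves.lean`, this seat,
review-queued at the time of writing). So that this ROUTE-FREE file does not wait on the review queue,
the theorems below carry that statement SPELLED OUT as the section hypothesis `hLS` (its text is the
Literature def's body with `O6.ModPCongruent` for the inline torsion isomorphism — definitionally equal;
once the fact lands, `hLS := LimSujatha2018.prop32_…` discharges the binder by `exact`). Pattern:
`GreenbergVatsal2000/CongruentCurves.lean` (`hGr` = Greenberg's Thm. 4.1 spelled inline). -/

section Road

variable (hLS : ∀ (W₁ W₂ : WeierstrassCurve ℚ) [W₁.IsElliptic] [W₂.IsElliptic] (p : ℕ) [Fact p.Prime],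
    ModPCongruent W₁ W₂ p → ∀ (κ : ZpExtension ℚ p), κ.IsCyclotomic →
      ((∃ (γ : Field.absoluteGaloisGroup ℚ) (D : W₁.FineSelmerDualData κ γ),
          Module.Finite ℤ_[p] (RestrictScalars ℤ_[p] (IwasawaAlgebra p) D.X)) ↔
        ∃ (γ : Field.absoluteGaloisGroup ℚ) (D : W₂.FineSelmerDualData κ γ),
          Module.Finite ℤ_[p] (RestrictScalars ℤ_[p] (IwasawaAlgebra p) D.X)))

include hLS

/-! ## §1 Row transfer of (A) along a mod-`p` congruence -/

/-- **(A) at `(W,p)` from (A) at `(W′,p)` for a congruent `W′`** (`W′[p] ≃ W[p]` `Γ_ℚ`-equivariantly,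
`O6.ModPCongruent W′ W p`), granted Lim–Sujatha (`hLS`). The congruence is used from `W′` to `W`
(o6-r1's anchor orientation). [cite: LimSujatha2018, §3 Prop. 3.2] -/
theorem conjA_of_modPCongruent
    {W W' : WeierstrassCurve ℚ} [W.IsElliptic] [W'.IsElliptic] {p : ℕ} [Fact p.Prime]
    (hcong : ModPCongruent W' W p)
    (hA' : ∀ (κ : ZpExtension ℚ p), κ.IsCyclotomic →
      ∃ (γ : Field.absoluteGaloisGroup ℚ) (D : W'.FineSelmerDualData κ γ),
        Module.Finite ℤ_[p] (RestrictScalars ℤ_[p] (IwasawaAlgebra p) D.X)) :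
    ∀ (κ : ZpExtension ℚ p), κ.IsCyclotomic →
      ∃ (γ : Field.absoluteGaloisGroup ℚ) (D : W.FineSelmerDualData κ γ),
        Module.Finite ℤ_[p] (RestrictScalars ℤ_[p] (IwasawaAlgebra p) D.X) :=
  fun κ hκ ↦ (hLS W' W p hcong κ hκ).mp (hA' κ hκ)

/-- **o6-r1's (T-μ) at the Conj-A binding is the printed proposition.** With the interface
`FineMuZero W p` of `O6/X3KatoMemberBound.lean` / `O6/X4CongruenceAnchor.lean` bound to Coates–Sujatha's
(A) at `(W,p)` in the tree's `∃`-form (the body used by item 19386 and by p420034), the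
`@[conjecture]`-typed `O6.FineMuZeroCongruenceInvariant` follows from Lim–Sujatha (`hLS`).
[cite: LimSujatha2018, §3 Prop. 3.2] -/
theorem fineMuZeroCongruenceInvariant_conjA :
    FineMuZeroCongruenceInvariant (fun (W : WeierstrassCurve ℚ) (_ : W.IsElliptic) (p : ℕ) ↦
      ∀ [Fact p.Prime] (κ : ZpExtension ℚ p), κ.IsCyclotomic →
        ∃ (γ : Field.absoluteGaloisGroup ℚ) (D : W.FineSelmerDualData κ γ),
          Module.Finite ℤ_[p] (RestrictScalars ℤ_[p] (IwasawaAlgebra p) D.X)) := by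
  intro W _ W' _ p _ hcong hA _ κ hκ
  exact (hLS W W' p hcong κ hκ).mp (hA κ hκ)

/-! ## §2 o6-r1's export (Kμ-K) at the Conj-A binding is the fine-Selmer Kato fact p420034 -/

omit hLS in
/-- **`O6.X4UpperOfFineMuZero ⟨Conj A⟩` from p420034.** With `FineMuZero` bound to (A) in the tree's
`∃`-form, o6-r1's export (Kμ-K) (`@[conjecture] O6.X4UpperOfFineMuZero`, `O6/X3KatoMemberBound.lean`)
is VERBATIM the named Literature fact
`Kato2004.rankZero_padicValNat_sha_add_padicValNat_tamagawa_le_of_additive_potGood_of_irreducible_of_fineSelmerDual_fg`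
(Kato Thm. 14.5 (3) ⊕ Prop. 14.16 (2), Tamagawa-exact, (12.5.2) replaced by «irreducible ∧ (A)»;
k8t-c4 p420034, referee flag in its docstring). Conditional on that fact (`hKatoA`).
[cite: Kato2004Asterisque, Thm. 14.5 (3) (p. 236), Prop. 14.16 (2) (p. 244), Thm. 12.5 (3) (p. 222), 14.14 (p. 243)] -/
theorem x4UpperOfFineMuZero_conjA
    (hKatoA :
      Kato2004.rankZero_padicValNat_sha_add_padicValNat_tamagawa_le_of_additive_potGood_of_irreducible_of_fineSelmerDual_fg) :
    X4UpperOfFineMuZero (fun (W : WeierstrassCurve ℚ) (_ : W.IsElliptic) (p : ℕ) ↦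
      ∀ [Fact p.Prime] (κ : ZpExtension ℚ p), κ.IsCyclotomic →
        ∃ (γ : Field.absoluteGaloisGroup ℚ) (D : W.FineSelmerDualData κ γ),
          Module.Finite ℤ_[p] (RestrictScalars ℤ_[p] (IwasawaAlgebra p) D.X)) := by
  intro W _ _ p _ hp hgood hmult hj hirr hA hL hfin
  exact hKatoA W p hp hgood hmult hj hirr (fun κ hκ ↦ hA κ hκ) hL hfin

/-- **o6-r1's Elkies-corner target T-X4E below p420034 + Lim–Sujatha + ONE reading.** The
`@[conjecture]`-typed composite `O6.X4UpperOfCongruentUnitAnchor` (A161″ on an additive potentially good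
irreducible row GIVEN a congruent Kato unit anchor) follows from the fine-Selmer Kato fact (`hKatoA`),
Lim–Sujatha (`hLS`) and the one remaining reading (A⋆) at the Conj-A binding (`hAnchor` = o6-r1's
`FineMuZeroOfUnitAnchor`: a Kato unit anchor satisfies (A) — Kato 12.4 (3) + 12.5 (4) + Artin–Verdier +
Nakayama, THEOREM-CANDIDATE per lit-kato GEN 36 AUD-14, not yet a tree proof) — by o6-r1's kernel
composition `x4UpperOfCongruentUnitAnchor_of`. Census of record (o6-r1 GEN 22 C-X4E-0): 18 / 20 O6 ∧ r0
Elkies pairs carry ≥ 2 certified congruent unit anchors with `N′ ≤ 5·10⁵`. Conditional; nothing booked.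
[cite: Kato2004Asterisque, Thm. 12.4 (3) (p. 221), Thm. 12.5 (4) (p. 222), Thm. 14.5 (3) (p. 236)]
[cite: LimSujatha2018, §3 Prop. 3.2] -/
theorem x4UpperOfCongruentUnitAnchor_of_conjA
    (hKatoA :
      Kato2004.rankZero_padicValNat_sha_add_padicValNat_tamagawa_le_of_additive_potGood_of_irreducible_of_fineSelmerDual_fg)
    (hAnchor : FineMuZeroOfUnitAnchor (fun (W : WeierstrassCurve ℚ) (_ : W.IsElliptic) (p : ℕ) ↦
      ∀ [Fact p.Prime] (κ : ZpExtension ℚ p), κ.IsCyclotomic →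
        ∃ (γ : Field.absoluteGaloisGroup ℚ) (D : W.FineSelmerDualData κ γ),
          Module.Finite ℤ_[p] (RestrictScalars ℤ_[p] (IwasawaAlgebra p) D.X))) :
    X4UpperOfCongruentUnitAnchor :=
  x4UpperOfCongruentUnitAnchor_of _ (x4UpperOfFineMuZero_conjA hKatoA)
    (fineMuZeroCongruenceInvariant_conjA hLS) hAnchor

/-! ## §3 The K9 currency: the upper half on an irreducible wild row from a congruent Conj-A curve -/

omit hLS in
/-- Port (private; the public twin lives in a route-importing KT file and may not be restated): the
fine-Selmer Kato fact + GZK + modularity give `#Ш_an = q` with `ord_p #Ш ≤ ord_p q` on an irreducible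
additive potentially good rank-`0` row with (A) — no Tamagawa term, torsion term killed by
irreducibility. [cite: Kato2004Asterisque, Thm. 14.5 (3) (p. 236), Prop. 14.16 (2) (p. 244)]
[cite: Miller2011LMS, Def. 1.1] -/
private theorem missingUpperBoundAt_of_conjA_of_irreducible
    (hKatoA :
      Kato2004.rankZero_padicValNat_sha_add_padicValNat_tamagawa_le_of_additive_potGood_of_irreducible_of_fineSelmerDual_fg)
    (hGZK : rank_eq_analyticRank_of_analyticRank_le_one) (hmod : hasEntireLFunction_rat)
    (W : WeierstrassCurve ℚ) [W.IsElliptic] [W.IsGloballyMinimal] (p : ℕ) [Fact p.Prime]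
    (hp : p ≠ 2) (hgood : ¬ W.HasGoodReductionAtPrime p) (hmult : ¬ W.HasMultiplicativeReductionAtPrime p)
    (hpot : 0 ≤ padicValRat p W.j) (hirr : W.HasIrreducibleModPGaloisRep p)
    (hA : ∀ (κ : ZpExtension ℚ p), κ.IsCyclotomic →
      ∃ (γ : Field.absoluteGaloisGroup ℚ) (D : W.FineSelmerDualData κ γ),
        Module.Finite ℤ_[p] (RestrictScalars ℤ_[p] (IwasawaAlgebra p) D.X))
    (hr : W.analyticRank = 0) :
    MissingUpperBoundAt W p := by
  have hL : W.entireLFunction 1 ≠ 0 := (W.analyticRank_eq_zero_iff_holds (hmod W)).mp hr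
  obtain ⟨hmw, hfin⟩ := hGZK W (by rw [hr]; exact zero_le_one)
  haveI : Finite W.sha := hfin
  have hmw0 : W.mordellWeilRank = 0 := by rw [hmw, hr]
  obtain ⟨q₀, hq₀, hle⟩ := hKatoA W p hp hgood hmult hpot hirr hA hL hfin
  have hΩpos : 0 < W.realPeriodRat := W.realPeriodRat_pos_holds
  have hΩ : (W.realPeriodRat : ℂ) ≠ 0 := by exact_mod_cast hΩpos.ne'
  have hc0 : 0 < W.tamagawaProduct := W.tamagawaProduct_pos_holds
  have ht0 : 0 < W.torsionOrder := W.torsionOrder_pos_holds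
  have hq₀0 : q₀ ≠ 0 := by
    rintro rfl
    rw [Rat.cast_zero, div_eq_zero_iff] at hq₀
    exact hq₀.elim hL hΩ
  refine ⟨q₀ * (W.torsionOrder : ℚ) ^ 2 / (W.tamagawaProduct : ℚ), ?_, ?_⟩
  · have hLq : W.entireLFunction 1 = (q₀ : ℂ) * (W.realPeriodRat : ℂ) := by
      rw [← hq₀, div_mul_cancel₀ _ hΩ]
    rw [shaAn_def, leadingLCoeff_eq_of_analyticRank_eq_zero W hr,
      W.regulator_eq_one_of_rank_zero hmw0, hLq]
    push_cast
    field_simp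
  · have ht : (W.torsionOrder : ℚ) ≠ 0 := by exact_mod_cast ht0.ne'
    have hcq : (W.tamagawaProduct : ℚ) ≠ 0 := by exact_mod_cast hc0.ne'
    have hsha : padicValNat p (Nat.card (AddCommGroup.primaryComponent W.sha p)) =
        padicValNat p W.shaOrder := by
      unfold WeierstrassCurve.shaOrder
      exact padicValNat_card_addPrimaryComponent p
    have htors : padicValNat p W.torsionOrder = 0 :=
      padicValNat_torsionOrder_eq_zero_of_irreducible W p hirr
    have hv : padicValRat p (q₀ * (W.torsionOrder : ℚ) ^ 2 / (W.tamagawaProduct : ℚ)) =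
        padicValRat p q₀ + 2 * (padicValNat p W.torsionOrder : ℤ) -
          (padicValNat p W.tamagawaProduct : ℤ) := by
      rw [padicValRat.div (mul_ne_zero hq₀0 (pow_ne_zero 2 ht)) hcq,
        padicValRat.mul hq₀0 (pow_ne_zero 2 ht), pow_two, padicValRat.mul ht ht,
        padicValRat.of_nat, padicValRat.of_nat]
      ring
    rw [hv, htors, ← hsha]
    simp only [Nat.cast_zero, mul_zero, add_zero]
    linarith

/-- **THE CONGRUENCE ROAD, row form (K9 currency).** Granted the fine-Selmer Kato fact (`hKatoA`,
p420034), GZK (`hGZK`), modularity (`hmod`) and Lim–Sujatha (`hLS`): on an O6 row of analytic rank `0`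
with `W[3]` irreducible (tower surjective OR NOT, CM or not, ♭ or ♯), ONE elliptic curve `W′/ℚ` with
`W′[3] ≃ W[3]` `Γ_ℚ`-equivariantly and Coates–Sujatha's (A) at `(W′,3)` gives the upper half
`ord₃ #Ш(W) ≤ ord₃ #Ш_an(W)`. The anchor `W′` may have ANY reduction at `3` — additive with Kato's
(12.5.2) (o6-r1's unit anchors, Elkies rows) or good ordinary (classical `μ = 0`, the Cartan rows). No
census number is an input. Conditional; nothing booked. [cite: LimSujatha2018, §3 Prop. 3.2]
[cite: Kato2004Asterisque, Thm. 14.5 (3) (p. 236), Prop. 14.16 (2) (p. 244)] [cite: Miller2011LMS, Def. 1.1] -/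
theorem missingUpperBoundAt_wild_of_congruentConjA
    (hKatoA :
      Kato2004.rankZero_padicValNat_sha_add_padicValNat_tamagawa_le_of_additive_potGood_of_irreducible_of_fineSelmerDual_fg)
    (hGZK : rank_eq_analyticRank_of_analyticRank_le_one) (hmod : hasEntireLFunction_rat)
    (W : WeierstrassCurve ℚ) [W.IsElliptic] [W.IsGloballyMinimal] [Fact (3 : ℕ).Prime]
    (hr : W.analyticRank = 0) (hO : ClassO6 W 3) (hirr : W.HasIrreducibleModPGaloisRep 3)
    (hanchor : ∃ (W' : WeierstrassCurve ℚ) (_ : W'.IsElliptic), ModPCongruent W' W 3 ∧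
      ∀ (κ : ZpExtension ℚ 3), κ.IsCyclotomic →
        ∃ (γ : Field.absoluteGaloisGroup ℚ) (D : W'.FineSelmerDualData κ γ),
          Module.Finite ℤ_[3] (RestrictScalars ℤ_[3] (IwasawaAlgebra 3) D.X)) :
    MissingUpperBoundAt W 3 := by
  obtain ⟨W', hW', hcong, hA'⟩ := hanchor
  haveI := hW'
  exact missingUpperBoundAt_of_conjA_of_irreducible hKatoA hGZK hmod W 3 hO.1 hO.2.1.1 hO.2.1.2
    hO.padicValRat_j_nonneg hirr (conjA_of_modPCongruent hLS hcong hA') hr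

omit hLS in
/-- Irreducibility of `W[p]` comes for free from an irreducible anchor (transport along the congruence,
`Mazur1978.hasIrreducibleModPGaloisRep_of_addEquiv`): the road's `hirr` binder may be read off `W′`.
[folklore] -/
theorem hasIrreducibleModPGaloisRep_of_modPCongruent {W W' : WeierstrassCurve ℚ} {p : ℕ}
    (hcong : ModPCongruent W' W p) (hirr' : W'.HasIrreducibleModPGaloisRep p) :
    W.HasIrreducibleModPGaloisRep p := by
  obtain ⟨e, he⟩ := hcong
  exact Mazur1978.hasIrreducibleModPGaloisRep_of_addEquiv e he hirr'

/-! ## §4 The crux body (and its ♯-restriction) from per-row congruent certificates -/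

/-- **`WildFineSelmerCoatesSujatha` (item 19386) ⟸ Lim–Sujatha + ONE CONGRUENT Conj-A CURVE PER ROW.**
If every row of the crux (globally minimal, analytic rank `0`, `ClassO6` at `3`, `W[3]` irreducible,
3-adic tower not onto, no CM) admits an elliptic `W′/ℚ` with `W′[3] ≃ W[3]` (`Γ_ℚ`-equivariant) and
(A) at `(W′,3)` (hypothesis `hcert` — the per-row certificate; anchors as in the module docstring), then
the BODY of the route decl `WildFineSelmerCoatesSujatha` holds verbatim (this module imports no `Theses`
file; against the route decl the term elaborates by defeq unfolding). Conditional; the item is NOT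
closed. [cite: LimSujatha2018, §3 Prop. 3.2] [cite: CoatesSujatha2005, Conjecture A] -/
theorem wildFineSelmerCoatesSujatha_of_congruentCertificates
    (hcert : ∀ (W : WeierstrassCurve ℚ) [W.IsElliptic] [W.IsGloballyMinimal] [Fact (3 : ℕ).Prime],
      W.analyticRank = 0 → ClassO6 W 3 → W.HasIrreducibleModPGaloisRep 3 →
      ¬ (∀ n : ℕ, W.HasSurjectiveModNGaloisRep (3 ^ n : ℕ)) → ¬ W.HasCM →
      ∃ (W' : WeierstrassCurve ℚ) (_ : W'.IsElliptic), ModPCongruent W' W 3 ∧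
        ∀ (κ : ZpExtension ℚ 3), κ.IsCyclotomic →
          ∃ (γ : Field.absoluteGaloisGroup ℚ) (D : W'.FineSelmerDualData κ γ),
            Module.Finite ℤ_[3] (RestrictScalars ℤ_[3] (IwasawaAlgebra 3) D.X)) :
    ∀ (W : WeierstrassCurve ℚ) [W.IsElliptic] [W.IsGloballyMinimal] [Fact (3 : ℕ).Prime],
      W.analyticRank = 0 → ClassO6 W 3 → W.HasIrreducibleModPGaloisRep 3 →
      ¬ (∀ n : ℕ, W.HasSurjectiveModNGaloisRep (3 ^ n : ℕ)) → ¬ W.HasCM →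
      ∀ (κ : ZpExtension ℚ 3), κ.IsCyclotomic →
        ∃ (γ : Field.absoluteGaloisGroup ℚ) (D : W.FineSelmerDualData κ γ),
          Module.Finite ℤ_[3] (RestrictScalars ℤ_[3] (IwasawaAlgebra 3) D.X) := by
  intro W _ _ _ hr hO hirr hns hcm
  obtain ⟨W', hW', hcong, hA'⟩ := hcert W hr hO hirr hns hcm
  haveI := hW'
  exact conjA_of_modPCongruent hLS hcong hA'

/-- **The ♯-restricted Conj-A binder of the re-homed Heegner road from congruent certificates on the ♯
rows only.** The hypothesis `hCS♯` of
`WildUpperHeegnerRoad.wildUpperNonsurjTower_of_lower_of_rankOne_of_fineSelmerSharp` (p438322; = (A) on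
the non-CM rows with `3 ∣ ∏c_ℓ` or no Manin-clean datum at level `N_E`) follows from Lim–Sujatha and a
congruent Conj-A curve on each ♯ row. So after the planner's R100 re-cut the load-bearing input of the
U₀-ns child is: per ♯ row, ONE congruent curve with (A). Conditional; nothing booked.
[cite: LimSujatha2018, §3 Prop. 3.2] [cite: CoatesSujatha2005, Conjecture A] -/
theorem wildFineSelmerSharp_of_congruentCertificates
    (hcert : ∀ (W : WeierstrassCurve ℚ) [W.IsElliptic] [W.IsGloballyMinimal] [Fact (3 : ℕ).Prime],
      W.analyticRank = 0 → ClassO6 W 3 → W.HasIrreducibleModPGaloisRep 3 →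
      ¬ (∀ n : ℕ, W.HasSurjectiveModNGaloisRep (3 ^ n : ℕ)) →
      (3 ∣ W.tamagawaProduct ∨ ∀ [NeZero (W.conductorNorm ℤ)]
        (D : ModularForms.ModularParametrizationData W (W.conductorNorm ℤ)), (3 : ℤ) ∣ D.maninConstant) →
      ¬ W.HasCM →
      ∃ (W' : WeierstrassCurve ℚ) (_ : W'.IsElliptic), ModPCongruent W' W 3 ∧
        ∀ (κ : ZpExtension ℚ 3), κ.IsCyclotomic →
          ∃ (γ : Field.absoluteGaloisGroup ℚ) (D : W'.FineSelmerDualData κ γ),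
            Module.Finite ℤ_[3] (RestrictScalars ℤ_[3] (IwasawaAlgebra 3) D.X)) :
    ∀ (W : WeierstrassCurve ℚ) [W.IsElliptic] [W.IsGloballyMinimal] [Fact (3 : ℕ).Prime],
      W.analyticRank = 0 → ClassO6 W 3 → W.HasIrreducibleModPGaloisRep 3 →
      ¬ (∀ n : ℕ, W.HasSurjectiveModNGaloisRep (3 ^ n : ℕ)) →
      (3 ∣ W.tamagawaProduct ∨ ∀ [NeZero (W.conductorNorm ℤ)]
        (D : ModularForms.ModularParametrizationData W (W.conductorNorm ℤ)), (3 : ℤ) ∣ D.maninConstant) →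
      ¬ W.HasCM → ∀ (κ : ZpExtension ℚ 3), κ.IsCyclotomic →
        ∃ (γ : Field.absoluteGaloisGroup ℚ) (Df : W.FineSelmerDualData κ γ),
          Module.Finite ℤ_[3] (RestrictScalars ℤ_[3] (IwasawaAlgebra 3) Df.X) := by
  intro W _ _ _ hr hO hirr hns hsharp hcm
  obtain ⟨W', hW', hcong, hA'⟩ := hcert W hr hO hirr hns hsharp hcm
  haveI := hW'
  exact conjA_of_modPCongruent hLS hcong hA'

end Road

end Summit.BirchSwinnertonDyer.BirchSwinnertonDyer.Theorems.WildFineSelmerCongruence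

end
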